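import Summits.QuantumFields.YangMills.Theorems.BalabanUVNodesN21ShellSplitSelected13CoPHDefs
import Summits.QuantumFields.YangMills.Theorems.BalabanUVNodesN21ShellSplitOfRecord13CoPH

/-!
# N21 (NE7c) · THE SELECTED TOP CUT, TERM LEVEL: one cube's bands along a grid of cuts are DISJOINT, the COVER of a term's band by its cubes' bands, and the
# PIGEONHOLE — over the depths `i ≤ n` the bands of all terms weigh at most `#(top cubes) ×` the run's dressed partition sum, for ANY depth-indexed family of
# nonnegative slots under a pointwise envelope; the ARGMIN depth of two such families; at NODE 00's objects of record (generality `ϑ D g₀ os p g k`)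

R134 seat `pub-ymgap-dag-n21-d` (g10), node N21 = NE7c (NOT PRINTED, NOT proved at print's fixed thresholds), strategy s2; lane K3⁷ `SpineGivenEndpointR13SepCoPH`
(stmt-QuantumFields-20544, `--supports … --as helper`; COUNT-NEUTRAL).  Imports the definition lane `…N21ShellSplitSelected13CoPHDefs` (`cutGrid`, `bandWeightOfDatum₉`, …)
and g9's term-level file `…N21ShellSplitOfRecord13CoPH` (p592363: `measurable_cubeChiAt`, `cubeChiAt_nonneg ∕ _le_one`, `chiSeqOfRecordAt_eq_zero_or_one`; Weierstrass's
`one_sub_prod_le_sum_one_sub` [LevinPeres2017] (20.29) through it, CITED BY NAME).  Sequel (the record's terms, the keyed carriers and the face AT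
`crOfRecord₁₃At K₀ jcut (shellSplitSelected₁₃At N K₀ ρ n)`): `…N21ShellSplitSelected13CoPHKeyed`.

WHAT THIS FILE PROVES (theorems only; 0 `def`, 0 `sorry`; [folklore] finite-sum ∕ measure bookkeeping).
* §8 ONE CUBE: `cubeChiAt_mono_letter` (the (2.17) test is monotone in its letter); `sum_mul_one_sub_succ_le_one` (a `{0,1}`-sequence monotone in EITHER direction has
  `Σ_{i<m} c_i(1 − c_{i+1}) ≤ 1`); `geom_dichotomy` (a geometric sequence `ε·r^i`, `0 ≤ r`, is antitone or monotone — NO sign hypothesis on `ε`); ⇒ ★ `sum_cubeBand_le_one`: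
  along any antitone-or-monotone sequence of cut letters ONE cube's band indicators `χ_a^{θ_i}(1 − χ_a^{θ_{i+1}})` at the depths `i < m` sum to at most `1` (DISJOINT bands).
* §9 ONE TERM, POINTWISE: ★ `bandFactor_le_sum_cubeBand` — `χ_k^{θ}(s)(1 − χ_k^{θ′}(s)) ≤ Σ_{a} χ_a^{θ}(1 − χ_a^{θ′})` over ALL top cubes (Weierstrass at def-T's product face:
  if every cube of `s` passes at `θ` and some cube fails at `θ′`, that cube's band indicator is `1`); the band integrand lies in `[0, χ_k^{ε}(s)·slot_s]`.
* §10 ★★ THE PIGEONHOLE, GENERIC: `sum_range_sum_band_le_card_mul` — for depth-indexed nonnegative slot families `W_i(s)` with `Σ_s χ_k^{θ_i}(s)·W_i(s) ≤ env` pointwise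
  (integrable data displayed), `Σ_{i<m} Σ_s ∫ χ_k^{θ_i}(s)(1 − χ_k^{θ_{i+1}}(s))·W_i(s) ≤ #(top cubes) · ∫ env`; ★ `argmin_badness_bounds` — the argmin `i⋆` of
  `f∕S_f + g∕S_g` over `range m` for two nonnegative families with `Σ f ≤ C·S_f`, `Σ g ≤ C·S_g` has `f i⋆ ≤ (2C∕m)·S_f` AND `g i⋆ ≤ (2C∕m)·S_g` (degenerate masses included).
The record's instance (`W_i(s) := χ_k^{ε_k}(s)·slot_s` at every depth, `env :=` the dressed density, g9's COUNT) is §11 of the sequel.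

HONEST FRAMING.  [folklore] bookkeeping over NODE 00's objects of record; NO estimate of Bałaban's asserted or used; the selected band is ADJACENT to the record's
`ε_k`-cut terms only at depth `0` (A6: for an `ε_k`-cut consumer the selected split is worth no more than the zero split; its consumer is the THRESHOLD-LETTER reading,
where §10 applies verbatim with `W_i :=` the lettered slots and `env := ρ_k` by def-T's lettered unity — LOCATED, not typed); no `Provisos` inhabitant claimed (K0⁷ open);
NE7c NOT PRINTED ∕ NOT proved at print's thresholds; N21 NOT discharged; K3⁷ NOT claimed; counts UNMOVED (typed 28∕28 · discharged 5∕27); never a count claim.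
No `instance`, no `notation`, no `def`.  One finite four-torus programme at fixed `ε` — NOT ℝ⁴, NOT OS, NOT a mass gap, NOT the Clay problem.
-/

noncomputable section

open scoped BigOperators
open Finset MeasureTheory

namespace Summit.QuantumFields.YangMills.Theorems.N21ShellSplitOfRecord13CoPH

open Literature.MathematicalPhysics.QuantumFieldTheory.Balaban1983to89
open Literature.MathematicalPhysics.QuantumFieldTheory.Balaban1983to89.T4Continuum
open Literature.MathematicalPhysics.QuantumFieldTheory.Balaban1983to89.Node00
open Summit.QuantumFields.YangMills.BalabanUVNodes.N19MGFRoadLiveSelectorTower (dressedSlotsOfDatum₉_nonneg)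
open Literature.Probability.MarkovChains (one_sub_prod_le_sum_one_sub)

/-! ## §8 One cube: monotonicity of the test in its letter, and DISJOINTNESS of the bands along a monotone grid -/

section OneCube

variable (F : T4Family) (N : ℕ) [NeZero N] (ν : Stage7Numerics) (g : ℕ → ℝ) (Kc k : ℕ)

/-- **THE (2.17) TEST OF ONE CUBE IS MONOTONE IN ITS LETTER**: `δ ≤ δ′ ⇒ χ_a^{δ} ≤ χ_a^{δ′}` (the small-field event grows with the threshold; `η_k² ≥ 0`). [bookkeeping] -/
theorem cubeChiAt_mono_letter {δ δ' : ℝ} (h : δ ≤ δ') (a : ↥(cubeIndices (F.P Kc) (cubeSide (F.P Kc).L ν.M₂ (RkOfRecord (F.P Kc).L ν.r (g k)) k)))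
    (V : GaugeField (F.P Kc) k (SU N)) : cubeChiAt F N ν g Kc k δ a V ≤ cubeChiAt F N ν g Kc k δ' a V := by
  unfold cubeChiAt chiSmall
  have hη : δ * (F.P Kc).eta k ^ 2 ≤ δ' * (F.P Kc).eta k ^ 2 := mul_le_mul_of_nonneg_right h (sq_nonneg _)
  by_cases h1 : PlaqSmallOn (plaqInside (cubeEnl (F.P Kc) (cubeSide (F.P Kc).L ν.M₂ (RkOfRecord (F.P Kc).L ν.r (g k)) k) a 1)) (δ * (F.P Kc).eta k ^ 2)
      (B14.Eq216Concrete.ukBox (bgOfRecord (avOfRecord F N Kc) {U | PlaqSmall (ν.εreg * (F.P Kc).eta k ^ 2) U}) ν.M₁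
        (cubeEnl (F.P Kc) (cubeSide (F.P Kc).L ν.M₂ (RkOfRecord (F.P Kc).L ν.r (g k)) k) a 4) k V)
  · have h2 : PlaqSmallOn (plaqInside (cubeEnl (F.P Kc) (cubeSide (F.P Kc).L ν.M₂ (RkOfRecord (F.P Kc).L ν.r (g k)) k) a 1)) (δ' * (F.P Kc).eta k ^ 2)
        (B14.Eq216Concrete.ukBox (bgOfRecord (avOfRecord F N Kc) {U | PlaqSmall (ν.εreg * (F.P Kc).eta k ^ 2) U}) ν.M₁
          (cubeEnl (F.P Kc) (cubeSide (F.P Kc).L ν.M₂ (RkOfRecord (F.P Kc).L ν.r (g k)) k) a 4) k V) :=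
      fun q hq => lt_of_lt_of_le (h1 q hq) hη
    rw [if_pos h1, if_pos h2]
  · rw [if_neg h1]
    split_ifs <;> norm_num

variable {F N ν g Kc k} in
/-- **A `{0,1}`-SEQUENCE MONOTONE IN EITHER DIRECTION HAS `Σ_{i<m} c_i(1 − c_{i+1}) ≤ 1`**: antitone ⇒ the summands are `c_i − c_{i+1}` and telescope to `c_0 − c_m ≤ 1`;
monotone ⇒ every summand vanishes. [folklore] -/
theorem sum_mul_one_sub_succ_le_one {c : ℕ → ℝ} (h01 : ∀ i, c i = 0 ∨ c i = 1) (hmono : (∀ i, c (i + 1) ≤ c i) ∨ (∀ i, c i ≤ c (i + 1))) (m : ℕ) :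
    ∑ i ∈ Finset.range m, c i * (1 - c (i + 1)) ≤ 1 := by
  rcases hmono with hanti | hmon
  · -- antitone: `c_i(1 − c_{i+1}) = c_i − c_{i+1}`
    have hterm : ∀ i, c i * (1 - c (i + 1)) = c i - c (i + 1) := fun i => by
      rcases h01 i with h | h <;> rcases h01 (i + 1) with h' | h'
      · rw [h, h']; ring
      · exfalso; have := hanti i; rw [h, h'] at this; linarith
      · rw [h, h']; ring
      · rw [h, h']; ring
    simp_rw [hterm]
    rw [Finset.sum_range_sub']
    rcases h01 0 with h | h <;> rcases h01 m with h' | h' <;> rw [h, h'] <;> norm_num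
  · -- monotone: every summand vanishes
    have hterm : ∀ i, c i * (1 - c (i + 1)) = 0 := fun i => by
      rcases h01 i with h | h
      · rw [h]; ring
      · rcases h01 (i + 1) with h' | h'
        · exfalso; have := hmon i; rw [h, h'] at this; linarith
        · rw [h, h']; ring
    simp [hterm]

variable {F N ν g Kc k} in
/-- **A GEOMETRIC SEQUENCE WITH NONNEGATIVE RATIO IS ANTITONE OR MONOTONE** (four sign cases; NO sign hypothesis on `ε`). [folklore] -/
theorem geom_dichotomy (ε r : ℝ) (hr : 0 ≤ r) :
    (∀ i : ℕ, ε * r ^ (i + 1) ≤ ε * r ^ i) ∨ (∀ i : ℕ, ε * r ^ i ≤ ε * r ^ (i + 1)) := by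
  by_cases hε : 0 ≤ ε
  · by_cases hr1 : r ≤ 1
    · exact Or.inl fun i => by
        rw [pow_succ, ← mul_assoc]
        exact mul_le_of_le_one_right (mul_nonneg hε (pow_nonneg hr i)) hr1
    · exact Or.inr fun i => by
        rw [pow_succ, ← mul_assoc]
        exact le_mul_of_one_le_right (mul_nonneg hε (pow_nonneg hr i)) (le_of_lt (not_le.1 hr1))
  · have hε' : ε ≤ 0 := le_of_lt (not_le.1 hε)
    by_cases hr1 : r ≤ 1
    · exact Or.inr fun i => by
        have hp : ε * r ^ i ≤ 0 := mul_nonpos_of_nonpos_of_nonneg hε' (pow_nonneg hr i)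
        rw [pow_succ, ← mul_assoc]
        nlinarith
    · exact Or.inl fun i => by
        have hp : ε * r ^ i ≤ 0 := mul_nonpos_of_nonpos_of_nonneg hε' (pow_nonneg hr i)
        have hr1' : 1 ≤ r := le_of_lt (not_le.1 hr1)
        rw [pow_succ, ← mul_assoc]
        nlinarith

/-- ★ **ONE CUBE's BANDS ALONG AN ANTITONE-OR-MONOTONE SEQUENCE OF CUT LETTERS ARE DISJOINT**: `Σ_{i<m} χ_a^{θ_i}(V)(1 − χ_a^{θ_{i+1}}(V)) ≤ 1` at every field
(the cube indicators are `{0,1}`-valued and monotone in the letter, §8). [bookkeeping] -/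
theorem sum_cubeBand_le_one {θ : ℕ → ℝ} (hθ : (∀ i, θ (i + 1) ≤ θ i) ∨ (∀ i, θ i ≤ θ (i + 1))) (m : ℕ)
    (a : ↥(cubeIndices (F.P Kc) (cubeSide (F.P Kc).L ν.M₂ (RkOfRecord (F.P Kc).L ν.r (g k)) k))) (V : GaugeField (F.P Kc) k (SU N)) :
    ∑ i ∈ Finset.range m, cubeChiAt F N ν g Kc k (θ i) a V * (1 - cubeChiAt F N ν g Kc k (θ (i + 1)) a V) ≤ 1 := by
  refine sum_mul_one_sub_succ_le_one (c := fun i => cubeChiAt F N ν g Kc k (θ i) a V) (fun i => cubeChiAt_eq_zero_or_one F N ν g Kc k (θ i) a V) ?_ m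
  rcases hθ with h | h
  · exact Or.inl fun i => cubeChiAt_mono_letter F N ν g Kc k (h i) a V
  · exact Or.inr fun i => cubeChiAt_mono_letter F N ν g Kc k (h i) a V

end OneCube

/-! ## §9 One term, pointwise: the band factor is covered by the cubes' band indicators; the band integrand lies in `[0, χ_k(s)·slot_s]` -/

section Pointwise

variable (F : T4Family) (N : ℕ) [NeZero N] (ϑ : Stage9Params F N) (D : FiniteEpsData F (SU N)) (g₀ : ℕ → ℝ) (os : List (ULoop F))
  (p : B12.RunParams) (g : ℕ → ℝ) (k : ℕ)

/-- ★ **THE COVER OF A TERM's BAND FACTOR BY ITS CUBES' BAND INDICATORS**: `χ_k^{θ}(s)(1 − χ_k^{θ′}(s)) ≤ Σ_{a} χ_a^{θ}(1 − χ_a^{θ′})` over ALL top cubes — at def-T's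
product face the left side is `1` only if every cube of `s` passes at `θ` and some cube fails at `θ′` (Weierstrass `1 − Π q ≤ Σ (1 − q)`, then `Π p = 1 ⇒ p_a = 1`). [bookkeeping] -/
theorem bandFactor_le_sum_cubeBand (θ θ' : ℝ) (s : SeqOfRecord F ϑ.ν ϑ.τ9.M g p.K k) (V : GaugeField (F.P p.K) k (SU N)) :
    chiSeqOfRecordAt F N ϑ.ν ϑ.τ9.M g p.K k θ s V * (1 - chiSeqOfRecordAt F N ϑ.ν ϑ.τ9.M g p.K k θ' s V) ≤
      ∑ a, cubeChiAt F N ϑ.ν g p.K k θ a V * (1 - cubeChiAt F N ϑ.ν g p.K k θ' a V) := by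
  have hsum0 : 0 ≤ ∑ a, cubeChiAt F N ϑ.ν g p.K k θ a V * (1 - cubeChiAt F N ϑ.ν g p.K k θ' a V) :=
    Finset.sum_nonneg fun a _ => mul_nonneg (cubeChiAt_nonneg F N ϑ.ν g p.K k θ a V) (sub_nonneg.2 (cubeChiAt_le_one F N ϑ.ν g p.K k θ' a V))
  rcases chiSeqOfRecordAt_eq_zero_or_one F N ϑ p g k θ s V with h0 | h1
  · rw [h0, zero_mul]; exact hsum0
  · rw [h1, one_mul]
    have h1' := h1
    rw [chiSeqOfRecordAt_eq_prod_cubeChiAt] at h1'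
    -- every cube of `s` passes at `θ` (a vanishing factor would kill the product)
    have hall : ∀ a ∈ cubesOfSeq F ϑ.ν ϑ.τ9.M g p.K k s, cubeChiAt F N ϑ.ν g p.K k θ a V = 1 := by
      intro a ha
      rcases cubeChiAt_eq_zero_or_one F N ϑ.ν g p.K k θ a V with h | h
      · exfalso
        rw [Finset.prod_eq_zero ha h] at h1'
        exact zero_ne_one h1'
      · exact h
    calc 1 - chiSeqOfRecordAt F N ϑ.ν ϑ.τ9.M g p.K k θ' s V
        = 1 - ∏ a ∈ cubesOfSeq F ϑ.ν ϑ.τ9.M g p.K k s, cubeChiAt F N ϑ.ν g p.K k θ' a V := by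
          rw [chiSeqOfRecordAt_eq_prod_cubeChiAt]
      _ ≤ ∑ a ∈ cubesOfSeq F ϑ.ν ϑ.τ9.M g p.K k s, (1 - cubeChiAt F N ϑ.ν g p.K k θ' a V) :=
          one_sub_prod_le_sum_one_sub (cubesOfSeq F ϑ.ν ϑ.τ9.M g p.K k s) (a := fun a => cubeChiAt F N ϑ.ν g p.K k θ' a V)
            (fun a _ => cubeChiAt_nonneg F N ϑ.ν g p.K k θ' a V) (fun a _ => cubeChiAt_le_one F N ϑ.ν g p.K k θ' a V)
      _ = ∑ a ∈ cubesOfSeq F ϑ.ν ϑ.τ9.M g p.K k s, cubeChiAt F N ϑ.ν g p.K k θ a V * (1 - cubeChiAt F N ϑ.ν g p.K k θ' a V) :=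
          Finset.sum_congr rfl fun a ha => by rw [hall a ha, one_mul]
      _ ≤ ∑ a, cubeChiAt F N ϑ.ν g p.K k θ a V * (1 - cubeChiAt F N ϑ.ν g p.K k θ' a V) :=
          Finset.sum_le_univ_sum_of_nonneg fun a =>
            mul_nonneg (cubeChiAt_nonneg F N ϑ.ν g p.K k θ a V) (sub_nonneg.2 (cubeChiAt_le_one F N ϑ.ν g p.K k θ' a V))

/-- the band factor `χ_k^{θ}(s)(1 − χ_k^{θ′}(s))` is nonnegative. [bookkeeping] -/
theorem bandFactor_nonneg (θ θ' : ℝ) (s : SeqOfRecord F ϑ.ν ϑ.τ9.M g p.K k) (V : GaugeField (F.P p.K) k (SU N)) :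
    0 ≤ chiSeqOfRecordAt F N ϑ.ν ϑ.τ9.M g p.K k θ s V * (1 - chiSeqOfRecordAt F N ϑ.ν ϑ.τ9.M g p.K k θ' s V) :=
  mul_nonneg (chiSeqOfRecordAt_nonneg F N ϑ.ν ϑ.τ9.M g p.K k θ s V) (sub_nonneg.2 (chiSeqOfRecordAt_le_one F N ϑ.ν ϑ.τ9.M g p.K k θ' s V))

/-- the band factor `χ_k^{θ}(s)(1 − χ_k^{θ′}(s))` is at most `1`. [bookkeeping] -/
theorem bandFactor_le_one (θ θ' : ℝ) (s : SeqOfRecord F ϑ.ν ϑ.τ9.M g p.K k) (V : GaugeField (F.P p.K) k (SU N)) :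
    chiSeqOfRecordAt F N ϑ.ν ϑ.τ9.M g p.K k θ s V * (1 - chiSeqOfRecordAt F N ϑ.ν ϑ.τ9.M g p.K k θ' s V) ≤ 1 := by
  have h0 := chiSeqOfRecordAt_nonneg F N ϑ.ν ϑ.τ9.M g p.K k θ s V
  have h1 := chiSeqOfRecordAt_le_one F N ϑ.ν ϑ.τ9.M g p.K k θ s V
  have h0' := chiSeqOfRecordAt_nonneg F N ϑ.ν ϑ.τ9.M g p.K k θ' s V
  nlinarith

/-- **THE BAND INTEGRAND IS NONNEGATIVE** (`χ ≥ 0`, band factor `≥ 0`, `slot ≥ 0` from `0 ≤ w`). [bookkeeping] -/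
theorem bandIntegrand_nonneg (hw0 : ∀ k s' U V', 0 ≤ wOfRecord₉ F N ϑ p g k s' U V') (θ θ' t : ℝ) (s : SeqOfRecord F ϑ.ν ϑ.τ9.M g p.K k)
    (V : GaugeField (F.P p.K) k (SU N)) :
    0 ≤ chiSeqOfRecord F N ϑ.ν ϑ.τ9.M g p.K k s V *
      (chiSeqOfRecordAt F N ϑ.ν ϑ.τ9.M g p.K k θ s V * (1 - chiSeqOfRecordAt F N ϑ.ν ϑ.τ9.M g p.K k θ' s V)) *
      dressedSlotsOfDatum₉ F N ϑ D g₀ os t p g k s V :=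
  mul_nonneg (mul_nonneg (chiSeqOfRecord_nonneg F N ϑ.ν ϑ.τ9.M g p.K k s V) (bandFactor_nonneg F N ϑ p g k θ θ' s V))
    (dressedSlotsOfDatum₉_nonneg F N ϑ D g₀ os p g hw0 t k s V)

/-- **THE BAND INTEGRAND NEVER EXCEEDS THE CLASS-WEIGHT INTEGRAND** (band factor `≤ 1`; NO sign hypothesis on the letters). [bookkeeping] -/
theorem bandIntegrand_le (hw0 : ∀ k s' U V', 0 ≤ wOfRecord₉ F N ϑ p g k s' U V') (θ θ' t : ℝ) (s : SeqOfRecord F ϑ.ν ϑ.τ9.M g p.K k)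
    (V : GaugeField (F.P p.K) k (SU N)) :
    chiSeqOfRecord F N ϑ.ν ϑ.τ9.M g p.K k s V *
        (chiSeqOfRecordAt F N ϑ.ν ϑ.τ9.M g p.K k θ s V * (1 - chiSeqOfRecordAt F N ϑ.ν ϑ.τ9.M g p.K k θ' s V)) *
        dressedSlotsOfDatum₉ F N ϑ D g₀ os t p g k s V ≤
      chiSeqOfRecord F N ϑ.ν ϑ.τ9.M g p.K k s V * dressedSlotsOfDatum₉ F N ϑ D g₀ os t p g k s V := by
  have hχ := chiSeqOfRecord_nonneg F N ϑ.ν ϑ.τ9.M g p.K k s V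
  have hb := bandFactor_le_one F N ϑ p g k θ θ' s V
  have hsl := dressedSlotsOfDatum₉_nonneg F N ϑ D g₀ os p g hw0 t k s V
  have h1 : chiSeqOfRecord F N ϑ.ν ϑ.τ9.M g p.K k s V *
      (chiSeqOfRecordAt F N ϑ.ν ϑ.τ9.M g p.K k θ s V * (1 - chiSeqOfRecordAt F N ϑ.ν ϑ.τ9.M g p.K k θ' s V)) ≤
      chiSeqOfRecord F N ϑ.ν ϑ.τ9.M g p.K k s V := mul_le_of_le_one_right hχ hb
  exact mul_le_mul_of_nonneg_right h1 hsl

end Pointwise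

/-! ## §10 The pigeonhole, GENERIC: depth-indexed nonnegative slot families under a pointwise envelope; the argmin of a two-run badness -/

section Pigeonhole

variable (F : T4Family) (N : ℕ) [NeZero N] (ϑ : Stage9Params F N) (p : B12.RunParams) (g : ℕ → ℝ) (k : ℕ)

/-- ★★ **THE PIGEONHOLE OVER DEPTHS, GENERIC.**  Data: a sequence of cut letters `θ_i` that is antitone or monotone; depth-indexed NONNEGATIVE slot families `W_i(s)`
on the level-`k` fields with `χ_k^{θ_i}(s)·W_i(s)` integrable and a pointwise ENVELOPE `Σ_s χ_k^{θ_i}(s)(V)·W_i(s)(V) ≤ env(V)`, `env` integrable; (H-U) for the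
measurability of the front factors.  THEN over the depths `i < m` the bands of all terms weigh at most the NUMBER OF TOP CUBES times the envelope's mass:
`Σ_{i<m} Σ_s ∫ χ_k^{θ_i}(s)(1 − χ_k^{θ_{i+1}}(s))·W_i(s) ≤ #(top cubes) · ∫ env` (cover §9 + disjointness §8, summed and integrated).  At the record `W_i(s) = χ_k^{ε_k}(s)·slot_s`
for every depth (§11); on the threshold-letter road `W_i :=` the slots lettered at `θ_i` and `env := ρ_k` (lettered unity) — not typed here. [bookkeeping] -/
theorem sum_range_sum_band_le_card_mul (hU : LocalBgMeasurable F N ϑ.ν) {θ : ℕ → ℝ} (hθ : (∀ i, θ (i + 1) ≤ θ i) ∨ (∀ i, θ i ≤ θ (i + 1))) (m : ℕ)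
    (W : ℕ → SeqOfRecord F ϑ.ν ϑ.τ9.M g p.K k → GaugeField (F.P p.K) k (SU N) → ℝ) (hW0 : ∀ i s V, 0 ≤ W i s V)
    (hWint : ∀ i s, Integrable (fun V => chiSeqOfRecordAt F N ϑ.ν ϑ.τ9.M g p.K k (θ i) s V * W i s V) (fieldMeasure (F.P p.K) k (SU N)))
    (env : GaugeField (F.P p.K) k (SU N) → ℝ) (henvint : Integrable env (fieldMeasure (F.P p.K) k (SU N)))
    (henv : ∀ i V, ∑ s, chiSeqOfRecordAt F N ϑ.ν ϑ.τ9.M g p.K k (θ i) s V * W i s V ≤ env V) :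
    ∑ i ∈ Finset.range m, ∑ s, ∫ V, chiSeqOfRecordAt F N ϑ.ν ϑ.τ9.M g p.K k (θ i) s V *
        (1 - chiSeqOfRecordAt F N ϑ.ν ϑ.τ9.M g p.K k (θ (i + 1)) s V) * W i s V ∂fieldMeasure (F.P p.K) k (SU N) ≤
      ((cubeIndices (F.P p.K) (cubeSide (F.P p.K).L ϑ.ν.M₂ (RkOfRecord (F.P p.K).L ϑ.ν.r (g k)) k)).card : ℝ) *
        ∫ V, env V ∂fieldMeasure (F.P p.K) k (SU N) := by
  -- integrability of each band integrand: a `[0,1]`-valued measurable factor times an integrable piece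
  have hband : ∀ i s, Integrable (fun V => chiSeqOfRecordAt F N ϑ.ν ϑ.τ9.M g p.K k (θ i) s V *
      (1 - chiSeqOfRecordAt F N ϑ.ν ϑ.τ9.M g p.K k (θ (i + 1)) s V) * W i s V) (fieldMeasure (F.P p.K) k (SU N)) := by
    intro i s
    have h := (hWint i s).bdd_mul (c := 1)
      (((measurable_chiSeqOfRecordAt_of_localBg hU ϑ.τ9.M g p.K k (θ (i + 1)) s).const_sub (1 : ℝ)).aestronglyMeasurable)
      (ae_of_all _ fun V => by
        have h0 := chiSeqOfRecordAt_nonneg F N ϑ.ν ϑ.τ9.M g p.K k (θ (i + 1)) s V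
        have h1 := chiSeqOfRecordAt_le_one F N ϑ.ν ϑ.τ9.M g p.K k (θ (i + 1)) s V
        rw [Real.norm_eq_abs, abs_le]
        constructor <;> linarith)
    refine h.congr (ae_of_all _ fun V => ?_)
    simp only
    ring
  -- pointwise: the double sum of band integrands is at most `#cubes · env`
  have hpt : ∀ V, ∑ i ∈ Finset.range m, ∑ s, chiSeqOfRecordAt F N ϑ.ν ϑ.τ9.M g p.K k (θ i) s V *
      (1 - chiSeqOfRecordAt F N ϑ.ν ϑ.τ9.M g p.K k (θ (i + 1)) s V) * W i s V ≤
      ((cubeIndices (F.P p.K) (cubeSide (F.P p.K).L ϑ.ν.M₂ (RkOfRecord (F.P p.K).L ϑ.ν.r (g k)) k)).card : ℝ) * env V := by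
    intro V
    -- per depth: cover by the cubes' band indicators, then the envelope
    have hdepth : ∀ i, ∑ s, chiSeqOfRecordAt F N ϑ.ν ϑ.τ9.M g p.K k (θ i) s V *
        (1 - chiSeqOfRecordAt F N ϑ.ν ϑ.τ9.M g p.K k (θ (i + 1)) s V) * W i s V ≤
        (∑ a, cubeChiAt F N ϑ.ν g p.K k (θ i) a V * (1 - cubeChiAt F N ϑ.ν g p.K k (θ (i + 1)) a V)) * env V := by
      intro i
      have hB0 : 0 ≤ ∑ a, cubeChiAt F N ϑ.ν g p.K k (θ i) a V * (1 - cubeChiAt F N ϑ.ν g p.K k (θ (i + 1)) a V) :=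
        Finset.sum_nonneg fun a _ => mul_nonneg (cubeChiAt_nonneg F N ϑ.ν g p.K k _ a V) (sub_nonneg.2 (cubeChiAt_le_one F N ϑ.ν g p.K k _ a V))
      calc ∑ s, chiSeqOfRecordAt F N ϑ.ν ϑ.τ9.M g p.K k (θ i) s V * (1 - chiSeqOfRecordAt F N ϑ.ν ϑ.τ9.M g p.K k (θ (i + 1)) s V) * W i s V
          ≤ ∑ s, (∑ a, cubeChiAt F N ϑ.ν g p.K k (θ i) a V * (1 - cubeChiAt F N ϑ.ν g p.K k (θ (i + 1)) a V)) *
              (chiSeqOfRecordAt F N ϑ.ν ϑ.τ9.M g p.K k (θ i) s V * W i s V) := by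
            refine Finset.sum_le_sum fun s _ => ?_
            -- `χ(1 − χ′)·W = (χ(1 − χ′))·(χ·W)` since `χ ∈ {0,1}`; then the cover
            have hχW : 0 ≤ chiSeqOfRecordAt F N ϑ.ν ϑ.τ9.M g p.K k (θ i) s V * W i s V :=
              mul_nonneg (chiSeqOfRecordAt_nonneg F N ϑ.ν ϑ.τ9.M g p.K k _ s V) (hW0 i s V)
            have hsq : chiSeqOfRecordAt F N ϑ.ν ϑ.τ9.M g p.K k (θ i) s V * chiSeqOfRecordAt F N ϑ.ν ϑ.τ9.M g p.K k (θ i) s V =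
                chiSeqOfRecordAt F N ϑ.ν ϑ.τ9.M g p.K k (θ i) s V := by
              rcases chiSeqOfRecordAt_eq_zero_or_one F N ϑ p g k (θ i) s V with h | h <;> rw [h] <;> norm_num
            calc chiSeqOfRecordAt F N ϑ.ν ϑ.τ9.M g p.K k (θ i) s V * (1 - chiSeqOfRecordAt F N ϑ.ν ϑ.τ9.M g p.K k (θ (i + 1)) s V) * W i s V
                = (chiSeqOfRecordAt F N ϑ.ν ϑ.τ9.M g p.K k (θ i) s V * (1 - chiSeqOfRecordAt F N ϑ.ν ϑ.τ9.M g p.K k (θ (i + 1)) s V)) *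
                    (chiSeqOfRecordAt F N ϑ.ν ϑ.τ9.M g p.K k (θ i) s V * W i s V) := by
                  conv_lhs => rw [← hsq]
                  ring
              _ ≤ (∑ a, cubeChiAt F N ϑ.ν g p.K k (θ i) a V * (1 - cubeChiAt F N ϑ.ν g p.K k (θ (i + 1)) a V)) *
                    (chiSeqOfRecordAt F N ϑ.ν ϑ.τ9.M g p.K k (θ i) s V * W i s V) :=
                  mul_le_mul_of_nonneg_right (bandFactor_le_sum_cubeBand F N ϑ p g k (θ i) (θ (i + 1)) s V) hχW
        _ = (∑ a, cubeChiAt F N ϑ.ν g p.K k (θ i) a V * (1 - cubeChiAt F N ϑ.ν g p.K k (θ (i + 1)) a V)) *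
              ∑ s, chiSeqOfRecordAt F N ϑ.ν ϑ.τ9.M g p.K k (θ i) s V * W i s V := by rw [Finset.mul_sum]
        _ ≤ (∑ a, cubeChiAt F N ϑ.ν g p.K k (θ i) a V * (1 - cubeChiAt F N ϑ.ν g p.K k (θ (i + 1)) a V)) * env V :=
            mul_le_mul_of_nonneg_left (henv i V) hB0
    -- the envelope is nonnegative (it dominates a nonnegative sum)
    have henv0 : 0 ≤ env V := le_trans (Finset.sum_nonneg fun s _ =>
      mul_nonneg (chiSeqOfRecordAt_nonneg F N ϑ.ν ϑ.τ9.M g p.K k _ s V) (hW0 0 s V)) (henv 0 V)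
    -- sum over depths, swap, disjointness per cube
    calc ∑ i ∈ Finset.range m, ∑ s, chiSeqOfRecordAt F N ϑ.ν ϑ.τ9.M g p.K k (θ i) s V *
          (1 - chiSeqOfRecordAt F N ϑ.ν ϑ.τ9.M g p.K k (θ (i + 1)) s V) * W i s V
        ≤ ∑ i ∈ Finset.range m, (∑ a, cubeChiAt F N ϑ.ν g p.K k (θ i) a V * (1 - cubeChiAt F N ϑ.ν g p.K k (θ (i + 1)) a V)) * env V :=
          Finset.sum_le_sum fun i _ => hdepth i
      _ = (∑ a, ∑ i ∈ Finset.range m, cubeChiAt F N ϑ.ν g p.K k (θ i) a V * (1 - cubeChiAt F N ϑ.ν g p.K k (θ (i + 1)) a V)) * env V := by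
          rw [← Finset.sum_mul, Finset.sum_comm]
      _ ≤ (∑ _a : ↥(cubeIndices (F.P p.K) (cubeSide (F.P p.K).L ϑ.ν.M₂ (RkOfRecord (F.P p.K).L ϑ.ν.r (g k)) k)), (1 : ℝ)) * env V :=
          mul_le_mul_of_nonneg_right (Finset.sum_le_sum fun a _ => sum_cubeBand_le_one F N ϑ.ν g p.K k hθ m a V) henv0
      _ = ((cubeIndices (F.P p.K) (cubeSide (F.P p.K).L ϑ.ν.M₂ (RkOfRecord (F.P p.K).L ϑ.ν.r (g k)) k)).card : ℝ) * env V := by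
          rw [Finset.sum_const, nsmul_eq_mul, mul_one, Finset.card_univ, Fintype.card_coe]
  -- integrate
  calc ∑ i ∈ Finset.range m, ∑ s, ∫ V, chiSeqOfRecordAt F N ϑ.ν ϑ.τ9.M g p.K k (θ i) s V *
        (1 - chiSeqOfRecordAt F N ϑ.ν ϑ.τ9.M g p.K k (θ (i + 1)) s V) * W i s V ∂fieldMeasure (F.P p.K) k (SU N)
      = ∫ V, ∑ i ∈ Finset.range m, ∑ s, chiSeqOfRecordAt F N ϑ.ν ϑ.τ9.M g p.K k (θ i) s V *
        (1 - chiSeqOfRecordAt F N ϑ.ν ϑ.τ9.M g p.K k (θ (i + 1)) s V) * W i s V ∂fieldMeasure (F.P p.K) k (SU N) := by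
        rw [integral_finsetSum _ fun i _ => integrable_finsetSum _ fun s _ => hband i s]
        exact Finset.sum_congr rfl fun i _ => (integral_finsetSum _ fun s _ => hband i s).symm
    _ ≤ ∫ V, ((cubeIndices (F.P p.K) (cubeSide (F.P p.K).L ϑ.ν.M₂ (RkOfRecord (F.P p.K).L ϑ.ν.r (g k)) k)).card : ℝ) * env V
        ∂fieldMeasure (F.P p.K) k (SU N) :=
        integral_mono (integrable_finsetSum _ fun i _ => integrable_finsetSum _ fun s _ => hband i s) (henvint.const_mul _) hpt
    _ = ((cubeIndices (F.P p.K) (cubeSide (F.P p.K).L ϑ.ν.M₂ (RkOfRecord (F.P p.K).L ϑ.ν.r (g k)) k)).card : ℝ) *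
        ∫ V, env V ∂fieldMeasure (F.P p.K) k (SU N) := integral_const_mul _ _

variable {F N ϑ p g k} in
/-- ★ **THE ARGMIN OF A TWO-RUN BADNESS.**  Two nonnegative families `f, g` on the depths `range m` with `Σ f ≤ C·S_f`, `Σ g ≤ C·S_g` (`S_f, S_g, C ≥ 0`), and a depth
`i⋆ ∈ range m` minimising `f∕S_f + g∕S_g` there (`x∕0 = 0`).  THEN `f i⋆ ≤ (2C∕m)·S_f` AND `g i⋆ ≤ (2C∕m)·S_g` — the minimum is below the mean `≤ 2C∕m`, each normalised part
is below the badness, and a weightless run (`S = 0`) has all its masses `0`. [folklore] -/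
theorem argmin_badness_bounds {m : ℕ} {f g : ℕ → ℝ} {Sf Sg C : ℝ} (hf0 : ∀ i, 0 ≤ f i) (hg0 : ∀ i, 0 ≤ g i) (hSf : 0 ≤ Sf) (hSg : 0 ≤ Sg)
    (hC : 0 ≤ C) (hf : ∑ i ∈ Finset.range m, f i ≤ C * Sf) (hg : ∑ i ∈ Finset.range m, g i ≤ C * Sg) {i₀ : ℕ} (hi₀ : i₀ ∈ Finset.range m)
    (hmin : ∀ j ∈ Finset.range m, f i₀ / Sf + g i₀ / Sg ≤ f j / Sf + g j / Sg) :
    f i₀ ≤ 2 * C / m * Sf ∧ g i₀ ≤ 2 * C / m * Sg := by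
  have hm : (0 : ℝ) < m := by
    have : 0 < m := Finset.card_range m ▸ Finset.card_pos.2 ⟨i₀, hi₀⟩
    exact_mod_cast this
  -- each normalised total is at most `C`
  have hF : (∑ i ∈ Finset.range m, f i) / Sf ≤ C := by
    rcases eq_or_lt_of_le hSf with h | h
    · rw [← h, div_zero]; exact hC
    · rw [div_le_iff₀ h]; exact hf
  have hG : (∑ i ∈ Finset.range m, g i) / Sg ≤ C := by
    rcases eq_or_lt_of_le hSg with h | h
    · rw [← h, div_zero]; exact hC
    · rw [div_le_iff₀ h]; exact hg
  -- the minimum is below the mean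
  have hsum : (m : ℝ) * (f i₀ / Sf + g i₀ / Sg) ≤ 2 * C := by
    calc (m : ℝ) * (f i₀ / Sf + g i₀ / Sg) = ∑ _j ∈ Finset.range m, (f i₀ / Sf + g i₀ / Sg) := by
          rw [Finset.sum_const, nsmul_eq_mul, Finset.card_range]
      _ ≤ ∑ j ∈ Finset.range m, (f j / Sf + g j / Sg) := Finset.sum_le_sum hmin
      _ = (∑ j ∈ Finset.range m, f j) / Sf + (∑ j ∈ Finset.range m, g j) / Sg := by
          rw [Finset.sum_add_distrib, Finset.sum_div, Finset.sum_div]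
      _ ≤ 2 * C := by linarith
  have hbad : f i₀ / Sf + g i₀ / Sg ≤ 2 * C / m := by
    rw [le_div_iff₀ hm]; linarith
  have hfpart : f i₀ / Sf ≤ 2 * C / m := le_trans (le_add_of_nonneg_right (div_nonneg (hg0 i₀) hSg)) hbad
  have hgpart : g i₀ / Sg ≤ 2 * C / m := le_trans (le_add_of_nonneg_left (div_nonneg (hf0 i₀) hSf)) hbad
  have hK : 0 ≤ 2 * C / m := div_nonneg (by linarith) hm.le
  constructor
  · rcases eq_or_lt_of_le hSf with h | h
    · -- weightless run: all of `f` vanishes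
      have hle : f i₀ ≤ ∑ i ∈ Finset.range m, f i := Finset.single_le_sum (fun i _ => hf0 i) hi₀
      rw [← h, mul_zero] at hf ⊢
      linarith
    · rwa [div_le_iff₀ h] at hfpart
  · rcases eq_or_lt_of_le hSg with h | h
    · have hle : g i₀ ≤ ∑ i ∈ Finset.range m, g i := Finset.single_le_sum (fun i _ => hg0 i) hi₀
      rw [← h, mul_zero] at hg ⊢
      linarith
    · rwa [div_le_iff₀ h] at hgpart

end Pigeonhole


end Summit.QuantumFields.YangMills.Theorems.N21ShellSplitOfRecord13CoPH

end
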